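import Summits.HodgeConjecture.HodgeConjecture.Theses.NikulinTwinTransport

/-!
# `TwinTwistorTransport` (stmt-HodgeConjecture-14522) · Negative · Nikulin parity obstruction

Negative knowledge for the informal crux `TwinTwistorTransport` (route NikulinTwinTransport, r4) and
for the carrier recipe feeding its clause (a) (route text, TWO-LAYER PLAN: "NikulinSerreCarrier ⇐
SerreBundleAtAnchor (F rank 2, c₁ = pr₂^*δ, …) → ElementaryTransformations (eight along X × Nⱼ,
c₁ ↦ 0, …)").  Along a GENERIC diagonal twistor line an untwisted sheaf can be carried only if its
`c₁` stays of type `(1,1)`, which forces `c₁ = 0` on both factors (Verbitsky; Huybrechts Ch. 7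
Def. 3.1: `W^⊥ ∩ Λ = 0`).  This file proves that `c₁ = 0` is UNREACHABLE from the Serre carrier by
the foreseen moves: the `Y′`-component of `c₁` starts at the even eight `δ = ½ΣNⱼ`, an elementary
transformation along `X × Nⱼ` (rank-one quotient) subtracts `Nⱼ`, a line-bundle twist adds `2l` with
`l ∈ NS(Y′)` (`Pic(X × Y′) = Pic X × Pic Y′`), and `δ ≠ Σ aⱼNⱼ + 2l` because the nodal classes
saturate to the Nikulin lattice `⟨Nⱼ, δ⟩` in `H²(Y′, ℤ)` (Nikulin 1975; Morrison 1984 §5;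
van Geemen–Sarti 2007 §1).  Consequence for the typed crux: clause (a)'s "(twisted)" is not optional
for this carrier — run Markman's twisted (Azumaya / κ-class) transport, which loses nothing here since
`c₁ = pr₂^*(·)` has no mixed Künneth square, or modify along a divisor of `Y′`-class
`≡ δ (mod ⟨Nⱼ⟩ + 2NS(Y′))`.  Model: `V = NS(Y′) ⊗ ℚ`, `n : Fin 8 → V` the nodal classes.
Refuter seat refuter-cdisprove-stmt-HodgeConjecture-14522-g2-0 (gen 2), 2026-08-15.
-/

namespace Summit.HodgeConjecture.HodgeConjecture.Theorems.TwinTwistorTransport.Negative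

open scoped BigOperators

variable {V : Type*} [AddCommGroup V] [Module ℚ V]

/-- Twice every element of the Nikulin lattice `⟨N₁,…,N₈, ½ΣNⱼ⟩_ℤ` lies in `⟨N₁,…,N₈⟩_ℤ`.
[folklore] -/
theorem two_smul_mem_nodalSpan (n : Fin 8 → V) {l : V}
    (hl : l ∈ Submodule.span ℤ (Set.range n ∪ {(1 / 2 : ℚ) • ∑ j, n j})) :
    (2 : ℤ) • l ∈ Submodule.span ℤ (Set.range n) := by
  induction hl using Submodule.span_induction with
  | mem x hx =>
    rcases hx with ⟨j, rfl⟩ | hx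
    · exact Submodule.smul_mem _ _ (Submodule.subset_span ⟨j, rfl⟩)
    · rw [Set.mem_singleton_iff] at hx
      subst hx
      have : (2 : ℤ) • ((1 / 2 : ℚ) • ∑ j, n j) = ∑ j, n j := by
        rw [← Int.cast_smul_eq_zsmul ℚ, smul_smul]; norm_num
      rw [this]
      exact Submodule.sum_mem _ fun j _ => Submodule.subset_span ⟨j, rfl⟩
  | zero => simp
  | add x y _ _ hx hy => rw [smul_add]; exact add_mem hx hy
  | smul a x _ hx => rw [smul_comm]; exact Submodule.smul_mem _ a hx

/-- NIKULIN PARITY OBSTRUCTION: if the nodal classes `n` are linearly independent and saturate, inside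
the lattice `NS`, to the Nikulin lattice `⟨n, ½Σ n⟩_ℤ`, then `½Σⱼ nⱼ ≠ Σⱼ aⱼ nⱼ + 2l` for all
integers `aⱼ` and all `l ∈ NS` — no sequence of nodal elementary transformations and line-bundle
twists takes `c₁ = pr₂^*δ` to `0`. [folklore] -/
theorem evenEight_ne_nodal_add_two_smul (n : Fin 8 → V) (hn : LinearIndependent ℚ n)
    (NS : Submodule ℤ V)
    (hsat : ∀ v ∈ NS, v ∈ Submodule.span ℚ (Set.range n) →
      v ∈ Submodule.span ℤ (Set.range n ∪ {(1 / 2 : ℚ) • ∑ j, n j}))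
    (a : Fin 8 → ℤ) {l : V} (hl : l ∈ NS) :
    (1 / 2 : ℚ) • ∑ j, n j ≠ ∑ j, a j • n j + (2 : ℤ) • l := by
  intro h
  have h2l : (2 : ℤ) • l = (1 / 2 : ℚ) • ∑ j, n j - ∑ j, a j • n j := by rw [h]; abel
  have hlQ : l ∈ Submodule.span ℚ (Set.range n) := by
    have hl2 : l = (1 / 2 : ℚ) • ((2 : ℤ) • l) := by
      rw [← Int.cast_smul_eq_zsmul ℚ, smul_smul]; norm_num
    rw [hl2, h2l]
    refine Submodule.smul_mem _ _ (Submodule.sub_mem _ ?_ ?_)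
    · exact Submodule.smul_mem _ _
        (Submodule.sum_mem _ fun j _ => Submodule.subset_span ⟨j, rfl⟩)
    · exact Submodule.sum_mem _ fun j _ => by
        rw [← Int.cast_smul_eq_zsmul ℚ]
        exact Submodule.smul_mem _ _ (Submodule.subset_span ⟨j, rfl⟩)
  have h2lZ : (2 : ℤ) • l ∈ Submodule.span ℤ (Set.range n) :=
    two_smul_mem_nodalSpan n (hsat l hl hlQ)
  have hδ : (1 / 2 : ℚ) • ∑ j, n j ∈ Submodule.span ℤ (Set.range n) := by
    rw [h]
    exact add_mem (Submodule.sum_mem _ fun j _ =>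
      Submodule.smul_mem _ _ (Submodule.subset_span ⟨j, rfl⟩)) h2lZ
  obtain ⟨c, hc⟩ := (Submodule.mem_span_range_iff_exists_fun ℤ).1 hδ
  have hcomb : ∑ j, ((c j : ℚ) - 1 / 2) • n j = 0 := by
    simp only [sub_smul, Finset.sum_sub_distrib, Int.cast_smul_eq_zsmul, hc, Finset.smul_sum,
      sub_self]
  have h0 := (Fintype.linearIndependent_iff.1 hn) _ hcomb 0
  have h0' : (c 0 : ℚ) = 1 / 2 := by linarith
  have h2 : (2 * c 0 : ℤ) = 1 := by
    exact_mod_cast (by rw [h0']; norm_num : (2 : ℚ) * (c 0 : ℚ) = 1)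
  omega

/-- Non-vacuity of the saturation hypothesis: in coordinates along the nodal classes take `NS` to be
the Nikulin lattice itself. [folklore] -/
theorem evenEight_ne_nodal_add_two_smul_nonvacuous :
    ∃ (n : Fin 8 → (Fin 8 → ℚ)) (NS : Submodule ℤ (Fin 8 → ℚ)),
      LinearIndependent ℚ n ∧
      (∀ v ∈ NS, v ∈ Submodule.span ℚ (Set.range n) →
        v ∈ Submodule.span ℤ (Set.range n ∪ {(1 / 2 : ℚ) • ∑ j, n j})) ∧
      (1 / 2 : ℚ) • ∑ j, n j ∈ NS :=
  ⟨Pi.basisFun ℚ (Fin 8), Submodule.span ℤ (Set.range (Pi.basisFun ℚ (Fin 8)) ∪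
      {(1 / 2 : ℚ) • ∑ j, Pi.basisFun ℚ (Fin 8) j}),
    (Pi.basisFun ℚ (Fin 8)).linearIndependent, fun _ hv _ => hv,
    Submodule.subset_span (Or.inr rfl)⟩

end Summit.HodgeConjecture.HodgeConjecture.Theorems.TwinTwistorTransport.Negative
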